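import Summits.AtomisticToContinuum.Crystallization.Theorems.AtomicLawChargesCrystal.Negative.FalseWithoutPointStationarity

/-!
# The interstitial crystal law is excluded from `AtomicLawChargesCrystal` ONLY by point-stationarity

Companion of `Negative.FalseWithoutPointStationarity` (crux stmt-AtomisticToContinuum-15778): the
witness `δ_{count|Y₀}`, `Y₀ = ℤ³ ∪ {(½,½,½)}`, used there satisfies the four other hypotheses of the
crux; here we certify that it violates exactly the deleted one — it is NOT point-stationary.
Re-rooting `Y₀` at any of its points `y ≠ 0` changes the configuration (`map_sub_interConfig_ne`:
at a lattice point `n ≠ 0` the site `c + n` would have to be occupied, at `c` the site `-c`), so the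
Mecke identity tested with `g(μ, y) = 1{μ = count|Y₀}` reads `∞ = 1`
(`not_isPointStationaryLaw_dirac_interstitial`).  Refuter crux-disprover, cycle 1; supports item
stmt-AtomisticToContinuum-15778.
-/

noncomputable section

open MeasureTheory
open scoped ENNReal

namespace Summit.AtomisticToContinuum.Crystallization.Theorems.AtomicLawChargesCrystal.Negative.InterstitialNotPointStationary

open Literature.Probability.Process
open Literature.MathematicalPhysics.StatisticalMechanics
open LatticeLaw FalseWithoutPointStationarity

local notation "E3" => EuclideanSpace ℝ (Fin 3)

/-- `c ∉ ℤ³` (its coordinates are not integers). -/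
theorem ctr_not_mem_zCube : ctr ∉ zCube := by
  rintro ⟨n, hn⟩
  have h := congrArg (fun v : E3 => v 0) hn
  simp only [zVec_apply, ctr_apply] at h
  have h2 : ((2 * n 0 : ℤ) : ℝ) = 1 := by push_cast; linarith
  norm_cast at h2
  omega

/-- `-c ∉ ℤ³`. -/
theorem neg_ctr_not_mem_zCube : -ctr ∉ zCube := by
  rintro ⟨n, hn⟩
  have h := congrArg (fun v : E3 => v 0) hn
  simp only [zVec_apply] at h
  have h' : (n 0 : ℝ) = -(1 / 2) := by rw [h]; rfl
  have h2 : ((2 * n 0 : ℤ) : ℝ) = -1 := by push_cast; linarith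
  norm_cast at h2
  omega

/-- `-c ≠ c`. -/
theorem neg_ctr_ne_ctr : -ctr ≠ ctr := by
  intro h
  have h0 := congrArg (fun v : E3 => v 0) h
  simp only [ctr_apply] at h0
  have : (-ctr) 0 = -(1 / 2 : ℝ) := rfl
  rw [this] at h0
  norm_num at h0

/-- `Y₀` is infinite (it contains `ℤ · (1,1,1)`). -/
theorem interSet_infinite : interSet.Infinite := by
  refine Set.infinite_of_injective_forall_mem (f := fun k : ℤ => zVec fun _ => k) ?_
    (fun k => zCube_subset_interSet ⟨_, rfl⟩)
  intro k l hkl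
  have h := congrArg (fun v : E3 => v 0) hkl
  simp only [zVec_apply] at h
  exact_mod_cast h

/-- Re-rooting the interstitial crystal at any point other than the root changes it. -/
theorem map_sub_interConfig_ne {y : E3} (hy : y ≠ 0) :
    interConfig.map (fun z => z - y) ≠ interConfig := by
  intro hEq
  unfold interConfig at hEq
  rw [map_sub_count_restrict] at hEq
  have hiff : ∀ v : E3, v ∈ (fun z => z - y) '' interSet ↔ v ∈ interSet := fun v => by
    rw [← count_restrict_singleton_ne_zero_iff, hEq, count_restrict_singleton_ne_zero_iff]
  -- `y` is a point of `Y₀`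
  have hy0 : y ∈ interSet := by
    obtain ⟨x, hx, hxy⟩ := (hiff 0).2 zero_mem_interSet
    rwa [sub_eq_zero.1 hxy] at hx
  rcases hy0 with hyz | hyc
  · -- `y ∈ ℤ³ ∖ {0}`: then `c + y ∈ Y₀`, impossible
    obtain ⟨x, hx, hxy⟩ := (hiff ctr).2 ctr_mem_interSet
    have hxy' : x - y = ctr := hxy
    have hx' : x = ctr + y := sub_eq_iff_eq_add.1 hxy'
    rcases hx with hx | hx
    · exact ctr_not_mem_zCube (by simpa [hx'] using sub_mem_zCube hx hyz)
    · rw [Set.mem_singleton_iff, hx'] at hx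
      exact hy (by simpa using hx)
  · -- `y = c`: then `-c = 0 - c ∈ Y₀`, impossible
    rw [Set.mem_singleton_iff] at hyc
    subst hyc
    have hmem : -ctr ∈ interSet := (hiff (-ctr)).1 ⟨0, zero_mem_interSet, by simp⟩
    rcases hmem with h | h
    · exact neg_ctr_not_mem_zCube h
    · exact neg_ctr_ne_ctr h

/-- **The interstitial crystal law is NOT point-stationary** (so it is excluded from the crux by
exactly the deleted hypothesis): testing the Mecke identity with `g(μ, y) = 1{μ = count|Y₀}` gives
`count|Y₀ (ℝ³) = ∞` on the left and `#{y ∈ Y₀ : Y₀ - y = Y₀} = 1` on the right. -/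
theorem not_isPointStationaryLaw_dirac_interstitial :
    ¬ IsPointStationaryLaw (Measure.dirac interConfig : Measure (Measure E3)) := by
  intro hPS
  have ae_eq_interConfig : ∀ᵐ μ ∂(Measure.dirac interConfig : Measure (Measure E3)),
      μ = interConfig := ae_eq_dirac_countRestrict interSet_countable
  set S : Set (Measure E3) := {μ | μ = interConfig} with hSdef
  have hS : MeasurableSet S := measurableSet_setOf_eq_count_restrict interSet_countable
  have hg : Measurable (Function.uncurry fun (μ : Measure E3) (_ : E3) =>
      S.indicator (1 : Measure E3 → ℝ≥0∞) μ) :=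
    (measurable_one.indicator hS).comp measurable_fst
  have hid := hPS _ hg
  -- left-hand side: `∞`
  have hL : ∫⁻ μ, ∫⁻ _y, S.indicator (1 : Measure E3 → ℝ≥0∞) μ ∂μ
      ∂(Measure.dirac interConfig : Measure (Measure E3)) = ⊤ := by
    have hae : (fun μ : Measure E3 => ∫⁻ _y, S.indicator (1 : Measure E3 → ℝ≥0∞) μ ∂μ)
        =ᵐ[Measure.dirac interConfig] fun _ => ⊤ := by
      refine ae_eq_interConfig.mono fun μ hμ => ?_
      subst hμ
      simp only
      rw [Set.indicator_of_mem (show interConfig ∈ S from rfl), Pi.one_apply, lintegral_const,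
        one_mul]
      unfold interConfig
      rw [Measure.restrict_apply_univ, Measure.count_apply_infinite interSet_infinite]
    rw [lintegral_congr_ae hae, lintegral_const]
    simp
  -- right-hand side: at most `1`
  have hR : ∫⁻ μ, ∫⁻ y, S.indicator (1 : Measure E3 → ℝ≥0∞) (μ.map fun z => z - y) ∂μ
      ∂(Measure.dirac interConfig : Measure (Measure E3)) ≤ 1 := by
    have hae : (fun μ : Measure E3 =>
          ∫⁻ y, S.indicator (1 : Measure E3 → ℝ≥0∞) (μ.map fun z => z - y) ∂μ)
        =ᵐ[Measure.dirac interConfig] fun _ =>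
          ∫⁻ y, S.indicator (1 : Measure E3 → ℝ≥0∞) (interConfig.map fun z => z - y) ∂interConfig :=
      ae_eq_interConfig.mono fun μ hμ => by subst hμ; rfl
    rw [lintegral_congr_ae hae, lintegral_const, measure_univ, mul_one]
    calc ∫⁻ y, S.indicator (1 : Measure E3 → ℝ≥0∞) (interConfig.map fun z => z - y) ∂interConfig
        ≤ ∫⁻ y, ({0} : Set E3).indicator (1 : E3 → ℝ≥0∞) y ∂interConfig := by
          refine lintegral_mono fun y => ?_
          by_cases hy : y = 0
          · subst hy
            rw [Set.indicator_of_mem (Set.mem_singleton (0 : E3)), Pi.one_apply]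
            exact Set.indicator_apply_le' (fun _ => le_rfl) (fun _ => zero_le_one)
          · rw [Set.indicator_of_notMem (show interConfig.map (fun z => z - y) ∉ S from
              map_sub_interConfig_ne hy)]
            exact bot_le
      _ = interConfig {0} := lintegral_indicator_one (measurableSet_singleton 0)
      _ = 1 := isRootedHardCore_interConfig.measure_zero_singleton
  rw [hid] at hL
  rw [hL] at hR
  exact absurd hR (by simp)

end Summit.AtomisticToContinuum.Crystallization.Theorems.AtomicLawChargesCrystal.Negative.InterstitialNotPointStationary
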